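import Summits.QuantumFields.YangMills.Theorems.LuscherReductionTwistedTraceScalingBOStiffPiTransportKernel
import HarnessLib

/-!
# (B-ST) the bridge, abstract half: CHANGE OF DENSITY AND OF SELF-NORMALISED JUMP KERNEL on the flat side, double set integrals compared on `S × S`
# (lane A of S-BASE, crux `TwistedTraceScaling` stmt-QuantumFields-20203, C4-CORE, the (B-ST) pen, lead g22; `pub/ym-fleet/ym-luscher-20007-p1/HANDOFF-g22.md` §PLAN TO CLOSE hflat (3))

✓`…BOStiffFlatModel.flat_model_selfNormalised` is a Poincaré inequality `Var_S^{D₀}(g) ≤ P·½∫_S∫_S (g x − g y)²·G₀·(Z₀/I₀) + δ∫_S g²D₀` (`Z₀ = ∫_S D₀`, `I₀ = ∫_S∫_S G₀`) on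
a measure space; the true (pulled-back) door data are `D₁ = c_D·D₀` EXACTLY (✓`cD_flatMap`) and a kernel `G₁` with `G₀ ≤ A·G₁`, `G₁ ≤ B·G₀` on `S × S` (✓`kernel_flatMap_two_sided`,
`AB = e^{4η}`).  This file (abstract measurable space, any measure `m` with `m|_S` finite):
* `setIntegral₂_le_on` — `F₁ ≤ K·F₂` on `S × S` (bounded jointly measurable) ⇒ `∫_S∫_S F₁ ≤ K·∫_S∫_S F₂`; `jumpForm_mono_kernel_on` — the same against the weights `(g x − g y)²`;
* `setIntegral_mul_density_eq` — `∫_S f·(c·D) = c·∫_S f·D`;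
* ★★★ `flat_kernel_change` — the displayed inequality for `(D₀, G₀; P, δ)` implies the one for `(D₁, G₁; A·B·P, δ)` (self-normalisation makes `c_D` drop out), together with `0 < I₀`
  (from `0 < I₁`).
HONEST FRAMING: measure bookkeeping for a stub of a child of the CONDITIONAL route R2b1; (B-ST) OPEN; C4-CORE OPEN; not infinite volume, not a gap, not Clay.  No named facts, no `sorry`.
-/

set_option autoImplicit false

noncomputable section

open MeasureTheory
open scoped BigOperators ENNReal

namespace Summit.QuantumFields.YangMills.Theorems.FemtoTransferGap.StiffDoor

variable {X : Type*} [MeasurableSpace X] {m : Measure X} {S : Set X}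

/-- ★ **Double set integrals are monotone under a kernel domination on `S × S`**: `F₁ ≤ K·F₂` on `S × S`, both bounded jointly measurable, `m|_S` finite ⇒
`∫_S∫_S F₁ ≤ K·∫_S∫_S F₂`. [folklore] -/
theorem setIntegral₂_le_on (hS : MeasurableSet S) [IsFiniteMeasure (m.restrict S)] {F₁ F₂ : X → X → ℝ} {C₁ C₂ K : ℝ}
    (hF₁ : Measurable (Function.uncurry F₁)) (hF₁b : ∀ x y, |F₁ x y| ≤ C₁) (hF₂ : Measurable (Function.uncurry F₂)) (hF₂b : ∀ x y, |F₂ x y| ≤ C₂)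
    (hle : ∀ x ∈ S, ∀ y ∈ S, F₁ x y ≤ K * F₂ x y) :
    ∫ x in S, ∫ y in S, F₁ x y ∂m ∂m ≤ K * ∫ x in S, ∫ y in S, F₂ x y ∂m ∂m := by
  set μ := m.restrict S with hμ
  have hKF : Measurable (Function.uncurry fun x y => K * F₂ x y) := measurable_const.mul hF₂
  have hKFb : ∀ x y, |K * F₂ x y| ≤ |K| * C₂ := fun x y => by rw [abs_mul]; exact mul_le_mul_of_nonneg_left (hF₂b x y) (abs_nonneg _)
  have e2 : K * ∫ x, ∫ y, F₂ x y ∂μ ∂μ = ∫ x, ∫ y, K * F₂ x y ∂μ ∂μ := by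
    rw [← integral_const_mul]; exact integral_congr_ae (ae_of_all _ fun x => (integral_const_mul _ _).symm)
  change ∫ x, ∫ y, F₁ x y ∂μ ∂μ ≤ K * ∫ x, ∫ y, F₂ x y ∂μ ∂μ
  rw [e2, integral_integral_eq_prod (μ := μ) hF₁ hF₁b, integral_integral_eq_prod (μ := μ) hKF hKFb]
  have hS1 : ∀ᵐ x ∂μ, x ∈ S := by rw [hμ]; exact ae_restrict_mem hS
  have h1 : ∀ᵐ p ∂(μ.prod μ), p.1 ∈ S := (Measure.quasiMeasurePreserving_fst (μ := μ) (ν := μ)).ae hS1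
  have h2 : ∀ᵐ p ∂(μ.prod μ), p.2 ∈ S := (Measure.quasiMeasurePreserving_snd (μ := μ) (ν := μ)).ae hS1
  exact integral_mono_ae (integrable_prod_of_bdd (μ := μ) hF₁ hF₁b) (integrable_prod_of_bdd (μ := μ) hKF hKFb)
    ((h1.and h2).mono fun p hp => hle p.1 hp.1 p.2 hp.2)

/-- ★ **The jump form on `S` is monotone in the kernel on `S × S`**: `J₁ ≤ K·J₂` on `S × S` ⇒ `∫_S∫_S (g x − g y)²J₁ ≤ K·∫_S∫_S (g x − g y)²J₂` (bounded measurable data,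
`m|_S` finite). [folklore] -/
theorem jumpForm_mono_kernel_on (hS : MeasurableSet S) [IsFiniteMeasure (m.restrict S)] {g : X → ℝ} {J₁ J₂ : X → X → ℝ} {Cg CJ₁ CJ₂ K : ℝ}
    (hg : Measurable g) (hgb : ∀ x, |g x| ≤ Cg) (hJ₁ : Measurable (Function.uncurry J₁)) (hJ₁b : ∀ x y, |J₁ x y| ≤ CJ₁)
    (hJ₂ : Measurable (Function.uncurry J₂)) (hJ₂b : ∀ x y, |J₂ x y| ≤ CJ₂) (hJK : ∀ x ∈ S, ∀ y ∈ S, J₁ x y ≤ K * J₂ x y) :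
    ∫ x in S, ∫ y in S, (g x - g y) ^ 2 * J₁ x y ∂m ∂m ≤ K * ∫ x in S, ∫ y in S, (g x - g y) ^ 2 * J₂ x y ∂m ∂m := by
  have hd : Measurable (Function.uncurry fun x y => (g x - g y) ^ 2) := ((hg.comp measurable_fst).sub (hg.comp measurable_snd)).pow_const 2
  have hdb : ∀ x y, |(g x - g y) ^ 2| ≤ (2 * Cg) ^ 2 := fun x y => by
    rw [abs_pow]; exact pow_le_pow_left₀ (abs_nonneg _) ((abs_sub _ _).trans (by linarith [hgb x, hgb y])) 2
  have hF1b : ∀ x y, |(g x - g y) ^ 2 * J₁ x y| ≤ (2 * Cg) ^ 2 * CJ₁ := fun x y => by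
    rw [abs_mul]; exact mul_le_mul (hdb x y) (hJ₁b x y) (abs_nonneg _) (sq_nonneg _)
  have hF2b : ∀ x y, |(g x - g y) ^ 2 * J₂ x y| ≤ (2 * Cg) ^ 2 * CJ₂ := fun x y => by
    rw [abs_mul]; exact mul_le_mul (hdb x y) (hJ₂b x y) (abs_nonneg _) (sq_nonneg _)
  refine setIntegral₂_le_on (m := m) hS (hd.mul hJ₁) hF1b (hd.mul hJ₂) hF2b fun x hx y hy => ?_
  have := hJK x hx y hy
  nlinarith [sq_nonneg (g x - g y)]

/-- `∫_S f·(c·D) = c·∫_S f·D` for a density rescaled by a constant (`D₁ = c·D₀` pointwise). [folklore] -/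
theorem setIntegral_mul_density_eq {D₀ D₁ : X → ℝ} {c : ℝ} (hD : ∀ x, D₁ x = c * D₀ x) (f : X → ℝ) :
    ∫ x in S, f x * D₁ x ∂m = c * ∫ x in S, f x * D₀ x ∂m := by
  rw [← integral_const_mul]
  exact integral_congr_ae (ae_of_all _ fun x => by change f x * D₁ x = c * (f x * D₀ x); rw [hD x]; ring)

/-- ★★★ **CHANGE OF DENSITY AND OF SELF-NORMALISED KERNEL.**  On a measure space with `m|_S` finite let `g` be bounded measurable, `D₁ = c_D·D₀` (`c_D > 0`, `D₀ ≥ 0`), and let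
`G₀`, `G₁ ≥ 0` be bounded jointly measurable kernels with `G₀ ≤ A·G₁` and `G₁ ≤ B·G₀` on `S × S` (`A, B > 0`), `I₁ = ∫_S∫_S G₁ > 0`.  If
`∫_S g²D₀ − (∫_S gD₀)²/∫_S D₀ ≤ P·½∫_S∫_S (g x − g y)²·G₀·(∫_S D₀/∫_S∫_S G₀) + δ·∫_S g²D₀` (`P ≥ 0`), then `I₀ = ∫_S∫_S G₀ > 0` and
`∫_S g²D₁ − (∫_S gD₁)²/∫_S D₁ ≤ (A·B·P)·½∫_S∫_S (g x − g y)²·G₁·(∫_S D₁/∫_S∫_S G₁) + δ·∫_S g²D₁` — the density constant cancels. [cite: Helffer2013, §7] -/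
theorem flat_kernel_change (hS : MeasurableSet S) [IsFiniteMeasure (m.restrict S)]
    {g D₀ D₁ : X → ℝ} {G₀ G₁ : X → X → ℝ} {Cg C₀ C₁ cD A B P δ : ℝ}
    (hg : Measurable g) (hgb : ∀ x, |g x| ≤ Cg) (hD : ∀ x, D₁ x = cD * D₀ x) (hcD : 0 < cD) (hD0 : ∀ x, 0 ≤ D₀ x)
    (hG₀ : Measurable (Function.uncurry G₀)) (hG₀b : ∀ x y, |G₀ x y| ≤ C₀)
    (hG₁ : Measurable (Function.uncurry G₁)) (hG₁b : ∀ x y, |G₁ x y| ≤ C₁) (hG₁0 : ∀ x y, 0 ≤ G₁ x y)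
    (hA : 0 < A) (hB : 0 < B) (hAB : ∀ x ∈ S, ∀ y ∈ S, G₀ x y ≤ A * G₁ x y) (hBA : ∀ x ∈ S, ∀ y ∈ S, G₁ x y ≤ B * G₀ x y)
    (hI₁ : 0 < ∫ x in S, ∫ y in S, G₁ x y ∂m ∂m) (hP : 0 ≤ P)
    (h : (∫ x in S, g x ^ 2 * D₀ x ∂m) - (∫ x in S, g x * D₀ x ∂m) ^ 2 / (∫ x in S, D₀ x ∂m) ≤
      P * ((1 / 2) * ∫ x in S, ∫ y in S, (g x - g y) ^ 2 * (G₀ x y * ((∫ z in S, D₀ z ∂m) / ∫ z in S, ∫ w in S, G₀ z w ∂m ∂m)) ∂m ∂m) +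
        δ * ∫ x in S, g x ^ 2 * D₀ x ∂m) :
    0 < ∫ x in S, ∫ y in S, G₀ x y ∂m ∂m ∧
    (∫ x in S, g x ^ 2 * D₁ x ∂m) - (∫ x in S, g x * D₁ x ∂m) ^ 2 / (∫ x in S, D₁ x ∂m) ≤
      (A * B * P) * ((1 / 2) * ∫ x in S, ∫ y in S, (g x - g y) ^ 2 * (G₁ x y * ((∫ z in S, D₁ z ∂m) / ∫ z in S, ∫ w in S, G₁ z w ∂m ∂m)) ∂m ∂m) +
        δ * ∫ x in S, g x ^ 2 * D₁ x ∂m := by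
  set Z₀ := ∫ z in S, D₀ z ∂m with hZ₀
  set I₀ := ∫ z in S, ∫ w in S, G₀ z w ∂m ∂m with hI₀
  set Z₁ := ∫ z in S, D₁ z ∂m with hZ₁
  set I₁ := ∫ z in S, ∫ w in S, G₁ z w ∂m ∂m with hI₁'
  -- the two normalisations compare
  have hI01 : I₀ ≤ A * I₁ := setIntegral₂_le_on (m := m) hS hG₀ hG₀b hG₁ hG₁b hAB
  have hI10 : I₁ ≤ B * I₀ := setIntegral₂_le_on (m := m) hS hG₁ hG₁b hG₀ hG₀b hBA
  have hI₀pos : 0 < I₀ := by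
    by_contra hneg
    have hneg' : I₀ ≤ 0 := not_lt.mp hneg
    have : I₁ ≤ 0 := hI10.trans (mul_nonpos_of_nonneg_of_nonpos hB.le hneg')
    linarith
  refine ⟨hI₀pos, ?_⟩
  -- densities
  have hZ : Z₁ = cD * Z₀ := by
    rw [hZ₁, hZ₀, ← integral_const_mul]; exact integral_congr_ae (ae_of_all _ fun x => hD x)
  have hN : ∫ x in S, g x ^ 2 * D₁ x ∂m = cD * ∫ x in S, g x ^ 2 * D₀ x ∂m := setIntegral_mul_density_eq (m := m) hD _
  have hM : ∫ x in S, g x * D₁ x ∂m = cD * ∫ x in S, g x * D₀ x ∂m := setIntegral_mul_density_eq (m := m) hD _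
  have hZ₀0 : 0 ≤ Z₀ := integral_nonneg fun x => hD0 x
  -- the kernels `G₀·Z₀/I₀ ≤ (A·B/c_D)·(G₁·Z₁/I₁)` on `S × S`
  have hker : ∀ x ∈ S, ∀ y ∈ S, G₀ x y * (Z₀ / I₀) ≤ (A * B / cD) * (G₁ x y * (Z₁ / I₁)) := by
    intro x hx y hy
    have h1 : Z₀ / I₀ ≤ B * (Z₀ / I₁) := by
      rw [div_le_iff₀ hI₀pos, mul_div_assoc', div_mul_eq_mul_div, le_div_iff₀ hI₁]
      calc Z₀ * I₁ ≤ Z₀ * (B * I₀) := mul_le_mul_of_nonneg_left hI10 hZ₀0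
        _ = B * Z₀ * I₀ := by ring
    have h2 : Z₀ = Z₁ / cD := by rw [hZ, mul_div_cancel_left₀ _ hcD.ne']
    calc G₀ x y * (Z₀ / I₀) ≤ (A * G₁ x y) * (B * (Z₀ / I₁)) := mul_le_mul (hAB x hx y hy) h1 (div_nonneg hZ₀0 hI₀pos.le) (mul_nonneg hA.le (hG₁0 x y))
      _ = (A * B / cD) * (G₁ x y * (Z₁ / I₁)) := by rw [h2]; field_simp
  -- bounded measurable kernels for the monotonicity lemma
  have hJ₀m : Measurable (Function.uncurry fun x y => G₀ x y * (Z₀ / I₀)) := hG₀.mul measurable_const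
  have hJ₁m : Measurable (Function.uncurry fun x y => G₁ x y * (Z₁ / I₁)) := hG₁.mul measurable_const
  have hJ₀b : ∀ x y, |G₀ x y * (Z₀ / I₀)| ≤ C₀ * |Z₀ / I₀| := fun x y => by rw [abs_mul]; exact mul_le_mul_of_nonneg_right (hG₀b x y) (abs_nonneg _)
  have hJ₁b : ∀ x y, |G₁ x y * (Z₁ / I₁)| ≤ C₁ * |Z₁ / I₁| := fun x y => by rw [abs_mul]; exact mul_le_mul_of_nonneg_right (hG₁b x y) (abs_nonneg _)
  have hJF := jumpForm_mono_kernel_on (m := m) hS hg hgb hJ₀m hJ₀b hJ₁m hJ₁b hker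
  have hJF0 : 0 ≤ ∫ x in S, ∫ y in S, (g x - g y) ^ 2 * (G₁ x y * (Z₁ / I₁)) ∂m ∂m :=
    integral_nonneg fun x => integral_nonneg fun y => mul_nonneg (sq_nonneg _) (mul_nonneg (hG₁0 x y) (div_nonneg (by rw [hZ]; exact mul_nonneg hcD.le hZ₀0) hI₁.le))
  -- the variance rescales exactly
  have hVar : (∫ x in S, g x ^ 2 * D₁ x ∂m) - (∫ x in S, g x * D₁ x ∂m) ^ 2 / Z₁ =
      cD * ((∫ x in S, g x ^ 2 * D₀ x ∂m) - (∫ x in S, g x * D₀ x ∂m) ^ 2 / Z₀) := by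
    rw [hN, hM, hZ, mul_pow, sq cD, mul_assoc, mul_div_mul_left _ _ hcD.ne', mul_sub, mul_div_assoc]
  rw [hVar]
  have hcD0 : cD ≠ 0 := hcD.ne'
  set JF₁ := ∫ x in S, ∫ y in S, (g x - g y) ^ 2 * (G₁ x y * (Z₁ / I₁)) ∂m ∂m with hJF₁
  set N₀ := ∫ x in S, g x ^ 2 * D₀ x ∂m with hN₀
  calc cD * ((∫ x in S, g x ^ 2 * D₀ x ∂m) - (∫ x in S, g x * D₀ x ∂m) ^ 2 / Z₀)
      ≤ cD * (P * ((1 / 2) * ∫ x in S, ∫ y in S, (g x - g y) ^ 2 * (G₀ x y * (Z₀ / I₀)) ∂m ∂m) + δ * N₀) :=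
        mul_le_mul_of_nonneg_left h hcD.le
    _ ≤ cD * (P * ((1 / 2) * ((A * B / cD) * JF₁)) + δ * N₀) := by
        gcongr
    _ = (A * B * P) * ((1 / 2) * JF₁) + δ * ∫ x in S, g x ^ 2 * D₁ x ∂m := by
        rw [hN]; field_simp

end Summit.QuantumFields.YangMills.Theorems.FemtoTransferGap.StiffDoor

end
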